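import Mathlib
import HarnessLib
import Summits.HubbardSuperconductivity.HubbardSuperconductivity.Theses.LiebTwin
import Summits.HubbardSuperconductivity.HubbardSuperconductivity.Theorems.LiebTwinNoOnsiteODLROHalfFillingFalkBruch
import Summits.HubbardSuperconductivity.HubbardSuperconductivity.Theorems.LiebTwinNoOnsiteODLROHalfFillingPseudospinSinglet
import Summits.HubbardSuperconductivity.HubbardSuperconductivity.Theorems.LiebTwinNoOnsiteODLROHalfFillingPseudospinVector
import Summits.HubbardSuperconductivity.HubbardSuperconductivity.Theorems.LiebTwinNoOnsiteODLROPseudospinCeiling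
import Literature.MathematicalPhysics.QuantumLattice.HubbardHubbardModelEtaODLROProofs
import Literature.MathematicalPhysics.QuantumLattice.HubbardGroundStateDoublonBound
import Literature.MathematicalPhysics.QuantumLattice.RegionalNumberCharge

/-!
# The `δ = 0` endpoint of `NoOnsiteODLRO`: no on-site pair condensation at half filling, rate `O(L²/√U)`

Helper file (`--supports stmt-HubbardSuperconductivity-0933`, crux `NoOnsiteODLRO` shared by the routes
`LiebTwin` / `EnslavedA1g`; route-prover LiebTwin-0, session 5). The crux asks that every doped
(`δ ∈ (0, 1/2)`) repulsive ground-state sequence have vanishing on-site pair order density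
`Re⟨ψ_L, P_sᴴP_sψ_L⟩/L⁴ → 0`; it is research-open (crux census: no reflection positivity off half
filling). This file proves the statement AT half filling (`δ = 0`), where Lieb's spin-space reflection
positivity is available, with the summable rate:

* `onsitePairing_halfFilled_sq_le` / `onsitePairing_halfFilled_le` — for `U > 0`, `L ≥ 3` even and every
  (normalised) ground state `ψ` of `hubbardTorus 2 L 1 U` in the joint sector `(L², S^z = 0)`:
  **`Re⟨ψ, P_sᴴ P_s ψ⟩ ≤ √(8/U) · L²`** (`P_s = pairField sWave L`);
* `stub_noOnsiteODLRO_halfFilling` (registered stub) — hence for every such sequence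
  `Re⟨ψ_L, P_sᴴP_sψ_L⟩/L⁴ ≤ √(8/U)/L² → 0`: the crux's conclusion at `δ = 0`.

## The chain (all inputs are tree theorems)

1. Gaussian domination at `T = 0` (`gaussianDomination_halfFilled`, Kubo–Kishi Thm 1 at `β = ∞`) and its
   Falk–Bruch consequence (`chargeFluctuation_falkBruch`) for the sublattice-number fluctuation
   `φ = (N_A - L²/2) ψ` (field = indicator of the even sublattice `A`, `Σ k² = |A| = L²/2`):
   `‖φ‖⁴ ≤ ⟨φ,(H - E₀)φ⟩ · L²/(4U) · ‖ψ‖²`.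
2. The `f`-sum rule (`Pseudospin.two_mul_re_form_eq_neg_re` with
   `Pseudospin.doubleComm_numberDiag_sublattice_hamiltonian`): `2⟨N_Aψ,(H - E₀)N_Aψ⟩ = -⟨ψ, Tψ⟩ ≤ 4L² ‖ψ‖²`
   (`re_expect_hubbardTorus_zero_ge`), and `⟨φ,(H-E₀)φ⟩ = ⟨N_Aψ,(H-E₀)N_Aψ⟩`.
3. The pseudospin singlet (`etaLower/etaRaise_halfFilled_groundState_eq_zero`, Lieb's theorems via the
   Shiba dictionary) and Zhang's pseudospin-vector algebra: `η₁ψ = η_ε φ`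
   (`Pseudospin.numberDiag_sublattice_comm_etaLower`) and `η_ε†(η₁ψ) = 2φ`
   (`etaRaise_mulVec_etaLowerOne_of_vacuum`, from the mixed Yang commutator
   `etaLower_mulVec_etaRaise_mulVec₂`), whence `Re⟨ψ, P_sᴴP_sψ⟩ = 2‖η₁ψ‖² = 4‖φ‖²`.
Together: `(Re⟨ψ,P_sᴴP_sψ⟩)² = 16‖φ‖⁴ ≤ 8L⁴‖ψ‖⁴/U`.

References: K. Kubo, T. Kishi, Phys. Rev. B 41 (1990) 4866, Thms 1–2 [KuboKishi1990]; E. H. Lieb, Phys. Rev.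
Lett. 62 (1989) 1201 [LiebPRL1989]; S.-C. Zhang, Phys. Rev. Lett. 65 (1990) 120 [Zhang1990]; C. N. Yang,
S.-C. Zhang, Mod. Phys. Lett. B 4 (1990) 759 [YangZhang1990]; F. J. Dyson, E. H. Lieb, B. Simon, J. Stat.
Phys. 18 (1978) 335 [DLS1978]. Everything is proved (standard axioms); no definition, no named fact.
-/

-- the mandated namespace `Summit.<Summit>.<Problem>.Theorems` repeats `HubbardSuperconductivity`
set_option linter.dupNamespace false

noncomputable section

namespace Summit.HubbardSuperconductivity.HubbardSuperconductivity.Theorems.NoOnsiteODLRO.HalfFilling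

open Matrix Finset
open Literature.Probability.LatticeModels Literature.MathematicalPhysics.QuantumLattice
open scoped ComplexOrder

section Endpoint

variable {L : ℕ} [NeZero L]

/-- **On-site pairing of the half-filled repulsive ground state is `O(L²/√U)`** (the `δ = 0` endpoint
of `NoOnsiteODLRO`, with the summable rate). For `U > 0`, `L ≥ 3` even, `2(m+1) = L²` and every ground
state `ψ` of `H = hubbardTorus 2 L 1 U` in the joint sector `(L², S^z = 0)`:
`(Re⟨ψ, P_sᴴ P_s ψ⟩)² ≤ (8 L⁴ / U) ‖ψ‖⁴`, `P_s = pairField sWave L`.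
Chain: Gaussian domination (`gaussianDomination_halfFilled`, Kubo–Kishi at `T = 0`) ⇒ Falk–Bruch
(`chargeFluctuation_falkBruch`) for the sublattice-number fluctuation `φ = (N_A - L²/2)ψ`:
`‖φ‖⁴ ≤ ⟨φ,(H-E₀)φ⟩ · (|A|/2U) · ‖ψ‖²`; the `f`-sum rule `2⟨N_Aψ,(H-E₀)N_Aψ⟩ = -⟨ψ,Tψ⟩ ≤ 8|A| ‖ψ‖²`
(`two_mul_re_form_eq_neg_re`, `re_expect_hubbardTorus_zero_ge`); and Zhang's pseudospin `SU(2)` for the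
pseudospin singlet `ψ` (`etaLower/etaRaise_halfFilled_groundState_eq_zero`): `η₁ψ = η_ε φ`,
`η_ε† η₁ ψ = 2φ`, so `Re⟨ψ, P_sᴴP_sψ⟩ = 2‖η₁ψ‖² = 4‖φ‖²`. Kubo–Kishi, PRB 41 (1990) 4866, Thm 2 /
Remark; Zhang, PRL 65 (1990) 120; Lieb, PRL 62 (1989) 1201. [cite: KuboKishi1990, Theorem 2] -/
theorem onsitePairing_halfFilled_sq_le (hL : Even L) (h3 : 3 ≤ L) {U : ℝ} (hU : 0 < U) {m : ℕ}
    (hm : 2 * (m + 1) = L ^ 2) {ψ : Fock (Orb (FermionTorus 2 L))}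
    (hψ : IsGroundStateInSector (hubbardTorus 2 L 1 U) (2 * (m + 1)) 0 ψ) :
    ((expect ((pairField sWave L)ᴴ * pairField sWave L) ψ).re) ^ 2 ≤
      8 * (L : ℝ) ^ 4 / U * ((star ψ ⬝ᵥ ψ).re) ^ 2 := by
  obtain ⟨hmem, hne, hHψ⟩ := hψ
  set G := fermionTorusGraph 2 L with hGdef
  have hH : hubbardTorus 2 L 1 U = hamiltonian G 1 U := rfl
  set E₀ : ℝ := (hubbardTorus 2 L 1 U).minEnergyOn (szSector (2 * (m + 1)) 0) with hE₀
  have hcard : Fintype.card (FermionTorus 2 L) = L ^ 2 := card_fermionTorus 2 L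
  have hnn : (m + 1) + (m + 1) = Fintype.card (FermionTorus 2 L) := by omega
  have hnle : m + 1 ≤ Fintype.card (FermionTorus 2 L) := by omega
  have hψsec : IsInSector (m + 1) (m + 1) ψ := (mem_szSector_two_mul_zero_iff (m + 1) ψ).1 hmem
  have hN : IsNParticle (2 * (m + 1)) ψ := ((mem_szSector_iff _ _ _).1 hmem).1
  -- the sublattice `A` and its number operator
  set A : Finset (FermionTorus 2 L) := Finset.univ.filter fun x => torusStagger x = 1 with hAdef
  have hA2 : 2 * A.card = L ^ 2 := LiebTwoHoppings.two_mul_card_filter_torusStagger_eq_one (L := L) hL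
  have hAcard : A.card = m + 1 := by omega
  set NA : Matrix (Finset (Orb (FermionTorus 2 L))) (Finset (Orb (FermionTorus 2 L))) ℂ :=
    diagonal (fun s : Finset (Orb (FermionTorus 2 L)) => (((s ∩ orbs A).card : ℕ) : ℂ)) with hNAdef
  have hNAsum : NA = ∑ x ∈ A, ∑ σ : Fin 2, numberOp x σ := numberDiag_orbs_eq_sum_numberOp A
  -- the indicator field of `A`
  set k : FermionTorus 2 L → ℝ := fun x => if x ∈ A then 1 else 0 with hkdef
  have hkC : ∀ x, ((k x : ℝ) : ℂ) = if x ∈ A then 1 else 0 := fun x => by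
    by_cases hx : x ∈ A <;> simp [hkdef, hx]
  have hfield : (∑ x : FermionTorus 2 L, ((k x : ℝ) : ℂ) • (numberOp x 0 + numberOp x 1)) = NA := by
    rw [hNAsum, ← Finset.sum_filter_add_sum_filter_not Finset.univ (fun x : FermionTorus 2 L => x ∈ A)]
    have hz : ∑ x ∈ Finset.univ.filter (fun x : FermionTorus 2 L => ¬x ∈ A),
        ((k x : ℝ) : ℂ) • (numberOp x 0 + numberOp x 1) = 0 :=
      Finset.sum_eq_zero fun x hx => by rw [hkC, if_neg (Finset.mem_filter.1 hx).2, zero_smul]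
    rw [hz, add_zero, Finset.filter_mem_eq_inter, Finset.univ_inter]
    refine Finset.sum_congr rfl fun x hx => ?_
    rw [hkC, if_pos hx, one_smul, Fin.sum_univ_two]
  have hksum : ∑ x : FermionTorus 2 L, k x = (m + 1 : ℕ) := by
    rw [← hAcard, hkdef, Finset.sum_boole, Finset.filter_mem_eq_inter, Finset.univ_inter]
  have hksq : ∑ x : FermionTorus 2 L, k x ^ 2 = (m + 1 : ℕ) := by
    rw [← hksum]
    refine Finset.sum_congr rfl fun x _ => ?_
    by_cases hx : x ∈ A <;> simp [hkdef, hx]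
  -- the fluctuation vector `φ = N_A ψ - |A| ψ`
  set φ : Fock (Orb (FermionTorus 2 L)) := NA *ᵥ ψ - (((m + 1 : ℕ) : ℝ) : ℂ) • ψ with hφdef
  have hφ' : φ = (∑ x : FermionTorus 2 L, ((k x : ℝ) : ℂ) • (numberOp x 0 + numberOp x 1)) *ᵥ ψ -
      ((∑ x : FermionTorus 2 L, k x : ℝ) : ℂ) • ψ := by rw [hfield, hksum]
  -- Falk–Bruch
  have hvar : ∀ χ : Fock (Orb (FermionTorus 2 L)), IsInSector (m + 1) (m + 1) χ →
      E₀ * (star χ ⬝ᵥ χ).re ≤ (star χ ⬝ᵥ (hamiltonian G 1 U *ᵥ χ)).re :=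
    fun χ hχ => (szSector_groundState G 1 U hnle).2 χ hχ
  have hHψ' : hamiltonian G 1 U *ᵥ ψ = (E₀ : ℂ) • ψ := hHψ
  have hFB := chargeFluctuation_falkBruch G A (torus_colouring hL) 1 hU hnn hvar hψsec hHψ' k φ hφ'
  rw [hksq] at hFB
  -- the `f`-sum rule: `⟨φ,(H-E₀)φ⟩ = ⟨N_Aψ,(H-E₀)N_Aψ⟩ = -Re⟨ψ,Tψ⟩/2 ≤ 4|A| ‖ψ‖²`
  set Kmat : Matrix (Finset (Orb (FermionTorus 2 L))) (Finset (Orb (FermionTorus 2 L))) ℂ :=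
    hamiltonian G 1 U - (E₀ : ℂ) • (1 : Matrix _ _ ℂ) with hKmatdef
  have hHherm : (hamiltonian G 1 U)ᴴ = hamiltonian G 1 U := (LiebThm1.hamiltonian_isHermitian G 1 U).eq
  have hKmat : Kmat.IsHermitian := by
    change Kmatᴴ = Kmat
    rw [hKmatdef, conjTranspose_sub, conjTranspose_smul, conjTranspose_one, hHherm, Complex.star_def,
      Complex.conj_ofReal]
  have hKv : ∀ χ : Fock (Orb (FermionTorus 2 L)), Kmat *ᵥ χ = hamiltonian G 1 U *ᵥ χ - (E₀ : ℂ) • χ := by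
    intro χ; rw [hKmatdef, sub_mulVec, smul_mulVec, one_mulVec]
  have hform : ∀ χ : Fock (Orb (FermionTorus 2 L)), (star χ ⬝ᵥ (Kmat *ᵥ χ)).re =
      (star χ ⬝ᵥ (hamiltonian G 1 U *ᵥ χ)).re - E₀ * (star χ ⬝ᵥ χ).re := by
    intro χ
    rw [hKv, dotProduct_sub, dotProduct_smul, smul_eq_mul, Complex.sub_re, Complex.re_ofReal_mul]
  have hKψ : Kmat *ᵥ ψ = 0 := by rw [hKv, hHψ', sub_self]
  have hQφ : (star φ ⬝ᵥ (hamiltonian G 1 U *ᵥ φ)).re - E₀ * (star φ ⬝ᵥ φ).re =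
      (star (NA *ᵥ ψ) ⬝ᵥ (hamiltonian G 1 U *ᵥ (NA *ᵥ ψ))).re - E₀ * (star (NA *ᵥ ψ) ⬝ᵥ (NA *ᵥ ψ)).re := by
    rw [← hform, ← hform, hφdef, tian_re_form_sub_smul hKmat, hKψ, dotProduct_zero, dotProduct_zero,
      Complex.zero_re]
    ring
  have hD := Pseudospin.doubleComm_numberDiag_sublattice_hamiltonian G torusStagger
    (fun x y h => torusStagger_eq_neg_of_adj_holds hL h) 1 U
  rw [← hAdef, ← hNAdef] at hD
  have hfsum := Pseudospin.two_mul_re_form_eq_neg_re (LiebThm1.hamiltonian_isHermitian G 1 U)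
    (isHermitian_numberDiag (orbs A)) hD hHψ'
  rw [← hNAdef] at hfsum
  have hT := re_expect_hubbardTorus_zero_ge _ h3 hψsec
  have hTG : hubbardTorus 2 L 1 0 = hamiltonian G 1 0 := rfl
  rw [hTG] at hT
  have hQle : (star (NA *ᵥ ψ) ⬝ᵥ (hamiltonian G 1 U *ᵥ (NA *ᵥ ψ))).re -
      E₀ * (star (NA *ᵥ ψ) ⬝ᵥ (NA *ᵥ ψ)).re ≤ 4 * (m + 1 : ℕ) * (star ψ ⬝ᵥ ψ).re := by
    push_cast at hT ⊢
    linarith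
  rw [hQφ] at hFB
  -- the pseudospin transfer `Re⟨ψ, P_sᴴ P_s ψ⟩ = 4 ‖φ‖²`
  have hη : etaLower torusStagger *ᵥ ψ = 0 :=
    etaLower_halfFilled_groundState_eq_zero hL hU hm ⟨hmem, hne, hHψ⟩
  have hη' : etaRaise torusStagger *ᵥ ψ = 0 :=
    etaRaise_halfFilled_groundState_eq_zero hL hU hm ⟨hmem, hne, hHψ⟩
  set y : Fock (Orb (FermionTorus 2 L)) := etaLower (fun _ : FermionTorus 2 L => (1 : ℤˣ)) *ᵥ ψ with hydef
  have hS : (expect ((pairField sWave L)ᴴ * pairField sWave L) ψ).re = 2 * (star y ⬝ᵥ y).re :=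
    Pseudospin.re_expect_pairField_sWave_eq ψ
  -- `y = η_ε φ`
  have hyφ : y = etaLower torusStagger *ᵥ φ := by
    have hc := Pseudospin.numberDiag_sublattice_comm_etaLower (Λ := FermionTorus 2 L) torusStagger
    rw [← hAdef, ← hNAdef] at hc
    have h1 : etaLower torusStagger * NA =
        NA * etaLower torusStagger + (etaLower torusStagger + etaLower fun _ => 1) := by
      calc etaLower torusStagger * NA
          = NA * etaLower torusStagger - (NA * etaLower torusStagger - etaLower torusStagger * NA) := by abel
        _ = NA * etaLower torusStagger + (etaLower torusStagger + etaLower fun _ => 1) := by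
            rw [hc, sub_neg_eq_add]
    rw [hφdef, mulVec_sub, mulVec_smul, hη, smul_zero, sub_zero, mulVec_mulVec, h1, add_mulVec, add_mulVec,
      ← mulVec_mulVec, hη, mulVec_zero, zero_add, zero_add]
  -- `η_ε† y = 2 φ`
  have h2φ : etaRaise torusStagger *ᵥ y = (2 : ℂ) • φ := by
    have h := etaRaise_mulVec_etaLowerOne_of_vacuum torusStagger (sum_torusStagger_cast_eq_zero hL) hN hη'
    rw [← hAdef, ← hNAsum] at h
    rw [hydef, h, hφdef, smul_sub, smul_smul]
    congr 1
    push_cast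
    ring
  -- `‖y‖² = 2 ‖φ‖²`
  have hLR : (etaLower (torusStagger (d := 2) (L := L)))ᴴ = etaRaise torusStagger :=
    conjTranspose_conjTranspose _
  have hyy : star y ⬝ᵥ y = 2 * (star φ ⬝ᵥ φ) := by
    conv_lhs => rw [hyφ]
    rw [EnslavedA1g.star_dotProduct_mulVec_eq_conjTranspose, hLR, ← hyφ, h2φ, star_smul, smul_dotProduct,
      smul_eq_mul]
    congr 1
    simp
  have hS4 : (expect ((pairField sWave L)ᴴ * pairField sWave L) ψ).re = 4 * (star φ ⬝ᵥ φ).re := by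
    rw [hS, hyy, show ((2 : ℂ) * (star φ ⬝ᵥ φ)).re = 2 * (star φ ⬝ᵥ φ).re by simp [Complex.mul_re]]
    ring
  -- assemble
  have hn2 : ((m + 1 : ℕ) : ℝ) = (L : ℝ) ^ 2 / 2 := by
    have : ((2 * (m + 1) : ℕ) : ℝ) = ((L ^ 2 : ℕ) : ℝ) := by rw [hm]
    push_cast at this ⊢
    linarith
  have hψψ : 0 ≤ (star ψ ⬝ᵥ ψ).re := (Complex.nonneg_iff.mp (dotProduct_star_self_nonneg _)).1
  have hφφ : 0 ≤ (star φ ⬝ᵥ φ).re := (Complex.nonneg_iff.mp (dotProduct_star_self_nonneg _)).1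
  rw [hS4]
  have hFB' : ((star φ ⬝ᵥ φ).re) ^ 2 ≤ 4 * (m + 1 : ℕ) * (star ψ ⬝ᵥ ψ).re *
      (((m + 1 : ℕ) : ℝ) / (2 * U) * (star ψ ⬝ᵥ ψ).re) :=
    hFB.trans (mul_le_mul_of_nonneg_right hQle (by positivity))
  rw [hn2] at hFB'
  have e : 4 * ((L : ℝ) ^ 2 / 2) * (star ψ ⬝ᵥ ψ).re * ((L : ℝ) ^ 2 / 2 / (2 * U) * (star ψ ⬝ᵥ ψ).re) =
      (L : ℝ) ^ 4 / (2 * U) * ((star ψ ⬝ᵥ ψ).re) ^ 2 := by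
    field_simp
    ring
  rw [e] at hFB'
  have e2 : (4 * (star φ ⬝ᵥ φ).re) ^ 2 = 16 * ((star φ ⬝ᵥ φ).re) ^ 2 := by ring
  have e3 : 8 * (L : ℝ) ^ 4 / U * ((star ψ ⬝ᵥ ψ).re) ^ 2 = 16 * ((L : ℝ) ^ 4 / (2 * U) * ((star ψ ⬝ᵥ ψ).re) ^ 2) := by
    field_simp
    ring
  rw [e2, e3]
  linarith

/-- **Unit-norm form of the endpoint**: for `U > 0`, `L ≥ 3` even, `2(m+1) = L²` and every normalised
ground state `ψ` of the sector `(L², S^z = 0)` of `hubbardTorus 2 L 1 U`,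
`Re⟨ψ, P_sᴴ P_s ψ⟩ ≤ √(8/U) · L²` — on-site pair correlations of the half-filled repulsive Hubbard torus
are summable (`O(L²)`, uniformly in `L`), with an explicit constant vanishing as `U → ∞`.
Kubo–Kishi, PRB 41 (1990) 4866, Thm 2 and Remark (no on-site pairing LRO at half filling; here at
`T = 0` with the rate). [cite: KuboKishi1990, Theorem 2] -/
theorem onsitePairing_halfFilled_le (hL : Even L) (h3 : 3 ≤ L) {U : ℝ} (hU : 0 < U) {m : ℕ}
    (hm : 2 * (m + 1) = L ^ 2) {ψ : Fock (Orb (FermionTorus 2 L))} (hψ1 : star ψ ⬝ᵥ ψ = 1)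
    (hψ : IsGroundStateInSector (hubbardTorus 2 L 1 U) (2 * (m + 1)) 0 ψ) :
    (expect ((pairField sWave L)ᴴ * pairField sWave L) ψ).re ≤ Real.sqrt (8 / U) * (L : ℝ) ^ 2 := by
  have h := onsitePairing_halfFilled_sq_le hL h3 hU hm hψ
  rw [hψ1, Complex.one_re, one_pow, mul_one] at h
  calc (expect ((pairField sWave L)ᴴ * pairField sWave L) ψ).re
      ≤ |(expect ((pairField sWave L)ᴴ * pairField sWave L) ψ).re| := le_abs_self _
    _ ≤ Real.sqrt (8 * (L : ℝ) ^ 4 / U) := Real.abs_le_sqrt h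
    _ = Real.sqrt (8 / U) * (L : ℝ) ^ 2 := by
        rw [show 8 * (L : ℝ) ^ 4 / U = 8 / U * ((L : ℝ) ^ 2) ^ 2 by ring, Real.sqrt_mul (by positivity),
          Real.sqrt_sq (by positivity)]

/-- An even `L ≥ 1` has `L² = 2(m+1)` for some `m`. [folklore] -/
theorem exists_two_mul_succ_eq_sq {L : ℕ} [NeZero L] (hL : Even L) : ∃ m : ℕ, 2 * (m + 1) = L ^ 2 := by
  obtain ⟨k, rfl⟩ := hL
  have hk : k ≠ 0 := by rintro rfl; exact (NeZero.ne (0 + 0)) rfl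
  refine ⟨2 * k * k - 1, ?_⟩
  have : 1 ≤ 2 * k * k := by
    have := Nat.pos_of_ne_zero hk
    nlinarith
  zify [this]
  ring

/-- **Registered stub `stub_noOnsiteODLRO_halfFilling`** of crux `NoOnsiteODLRO`
(stmt-HubbardSuperconductivity-0933; by-product, the `δ = 0` ENDPOINT of the crux's statement — not a piece
of a line composition): for every `U > 0` and every sequence `ψ_L` of normalised ground states of
`hubbardTorus 2 L 1 U` in the HALF-FILLED joint sector `(L², S^z = 0)` (even `L`), the on-site pair order
density vanishes: `∀ ε > 0, ∃ L₀, ∀ even L ≥ L₀, Re⟨ψ_L, P_sᴴP_sψ_L⟩ / L⁴ ≤ ε` — indeed it is `≤ √(8/U)/L²`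
(`onsitePairing_halfFilled_le`: Kubo–Kishi's Gaussian domination at `T = 0`, Falk–Bruch, the `f`-sum rule,
Lieb's theorems and Zhang's pseudospin `SU(2)`). The crux itself asks this for `δ ∈ (0, 1/2)`, where no
reflection positivity is available (census T1). Kubo–Kishi, PRB 41 (1990) 4866, Thm 2; Lieb, PRL 62 (1989)
1201; Zhang, PRL 65 (1990) 120. [cite: KuboKishi1990, Theorem 2] -/
theorem stub_noOnsiteODLRO_halfFilling : open Literature.MathematicalPhysics.QuantumLattice in ∀ (U : ℝ), 0 < U → ∀ (ψ : ∀ L : ℕ, Fock (Orb (FermionTorus 2 L))), (∀ (L : ℕ) [NeZero L], Even L → star (ψ L) ⬝ᵥ ψ L = 1 ∧ IsGroundStateInSector (hubbardTorus 2 L 1 U) (L ^ 2) 0 (ψ L)) → ∀ ε : ℝ, 0 < ε → ∃ L₀ : ℕ, ∀ (L : ℕ) [NeZero L], Even L → L₀ ≤ L → (expect ((pairField sWave L)ᴴ * pairField sWave L) (ψ L)).re / (L : ℝ) ^ 4 ≤ ε := by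
  intro U hU ψ hψ ε hε
  refine ⟨max 3 (⌈Real.sqrt (8 / U) / ε⌉₊ + 1), fun L _ hL hL₀ => ?_⟩
  have h3 : 3 ≤ L := le_trans (le_max_left _ _) hL₀
  have hLε : Real.sqrt (8 / U) / ε < L := by
    have h1 : (⌈Real.sqrt (8 / U) / ε⌉₊ + 1 : ℕ) ≤ L := le_trans (le_max_right _ _) hL₀
    have h2 : Real.sqrt (8 / U) / ε ≤ ⌈Real.sqrt (8 / U) / ε⌉₊ := Nat.le_ceil _
    have h3' : ((⌈Real.sqrt (8 / U) / ε⌉₊ + 1 : ℕ) : ℝ) ≤ L := by exact_mod_cast h1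
    push_cast at h3'
    linarith
  obtain ⟨m, hm⟩ := exists_two_mul_succ_eq_sq (L := L) hL
  obtain ⟨hψ1, hgs⟩ := hψ L hL
  rw [← hm] at hgs
  have hS := onsitePairing_halfFilled_le hL h3 hU hm hψ1 hgs
  have hLpos : (0 : ℝ) < L := by exact_mod_cast (show 0 < L by omega)
  have hL1 : (1 : ℝ) ≤ L := by exact_mod_cast (show 1 ≤ L by omega)
  rw [div_le_iff₀ (by positivity)]
  have hε' : Real.sqrt (8 / U) < ε * L := by rwa [div_lt_iff₀ hε, mul_comm] at hLε
  have hL34 : ε * L * (L : ℝ) ^ 2 ≤ ε * (L : ℝ) ^ 4 := by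
    have : (L : ℝ) * (L : ℝ) ^ 2 ≤ (L : ℝ) ^ 4 := by nlinarith [pow_pos hLpos 2, pow_pos hLpos 3]
    nlinarith [hε.le]
  calc (expect ((pairField sWave L)ᴴ * pairField sWave L) (ψ L)).re ≤ Real.sqrt (8 / U) * (L : ℝ) ^ 2 := hS
    _ ≤ ε * L * (L : ℝ) ^ 2 := by gcongr
    _ ≤ ε * (L : ℝ) ^ 4 := hL34

end Endpoint

end Summit.HubbardSuperconductivity.HubbardSuperconductivity.Theorems.NoOnsiteODLRO.HalfFilling
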